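import Summits.Parity.GeneralizedHardyLittlewood.Theorems.FordMaynardSieveConst01651SieveConst01651Dim5Check
import Summits.Parity.GeneralizedHardyLittlewood.Theorems.FordMaynardSieveConst01651SieveConst01651Witness
import HarnessLib

/-!
# Route `FordMaynardSieveConst01651`, target `SieveConst01651` (stmt-Parity-19185), stub `stub_coneCertClosed`,
# residue `h5`: soundness of the integer Farkas check of the dimension-5 type checker

Def-free helper file.  `…Dim5Check.farkasOK` re-checks, in integers, a certificate `(lam, mu)` against the 34 linear
constraints `rowC/rowR/rowS` of a type.  Here: if it passes, NO real point satisfies the constraints together with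
`∑ xₖ = 1` (`farkas_sound`) — the textbook Farkas alternative, easy direction: `∑_r lam_r·ℓ_r(x) = −mu·∑ xₖ = −mu`
while `∑_r lam_r·ℓ_r(x) < ∑_r lam_r·rhs_r ≤ −mu` (strict because some strict row has a positive multiplier).

References: [FordMaynard2024PrimeSieves] arXiv:2407.14368, §8.2 (empty types of the certificate's cell decomposition).
-/

namespace Summit.Parity.GeneralizedHardyLittlewood.FordMaynardSieveConst01651SieveConst01651

open Finset

/-- **Farkas, easy direction** (abstract form): non-negative multipliers `L` with `∑_r L_r C_{r,k} = −mu` for the five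
coordinates, `∑_r L_r R_r + 120000·mu ≤ 0` and a positive multiplier on some strict row contradict any `y` with
`∑ yₖ = 1`, `∑ₖ C_{r,k} yₖ ≤ R_r/120000` for all rows and `<` on strict rows. [folklore] -/
theorem farkas_sound_abstract (C : ℕ → ℕ → ℤ) (R : ℕ → ℤ) (S : ℕ → Bool) (L : ℕ → ℤ) (mu : ℤ)
    (hL : ∀ r, 0 ≤ L r)
    (hcoef : ∀ k ∈ range 5, (∑ r ∈ range 34, L r * C r k) + mu = 0)
    (hR : (∑ r ∈ range 34, L r * R r) + 120000 * mu ≤ 0)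
    (hS : 0 < ∑ r ∈ range 34, (if S r = true then L r else 0))
    (y : ℕ → ℝ) (hsum : ∑ k ∈ range 5, y k = 1)
    (hle : ∀ r ∈ range 34, (∑ k ∈ range 5, (C r k : ℝ) * y k) ≤ (R r : ℝ) / 120000)
    (hlt : ∀ r ∈ range 34, S r = true → (∑ k ∈ range 5, (C r k : ℝ) * y k) < (R r : ℝ) / 120000) : False := by
  have hLnn : ∀ r, (0 : ℝ) ≤ (L r : ℝ) := fun r => by exact_mod_cast hL r
  have hcoef' : ∀ k ∈ range 5, ∑ r ∈ range 34, (L r : ℝ) * (C r k : ℝ) = -(mu : ℝ) := by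
    intro k hk
    have h := hcoef k hk
    have h' : (((∑ r ∈ range 34, L r * C r k) + mu : ℤ) : ℝ) = 0 := by exact_mod_cast h
    push_cast at h'
    linarith
  -- T = ∑_r L_r · ℓ_r(y) = -mu
  have hT1 : ∑ r ∈ range 34, (L r : ℝ) * ∑ k ∈ range 5, (C r k : ℝ) * y k = -(mu : ℝ) := by
    calc ∑ r ∈ range 34, (L r : ℝ) * ∑ k ∈ range 5, (C r k : ℝ) * y k
          = ∑ r ∈ range 34, ∑ k ∈ range 5, (L r : ℝ) * (C r k : ℝ) * y k := by
            refine Finset.sum_congr rfl fun r _ => ?_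
            rw [Finset.mul_sum]
            refine Finset.sum_congr rfl fun k _ => ?_
            ring
      _ = ∑ k ∈ range 5, ∑ r ∈ range 34, (L r : ℝ) * (C r k : ℝ) * y k := Finset.sum_comm
      _ = ∑ k ∈ range 5, (∑ r ∈ range 34, (L r : ℝ) * (C r k : ℝ)) * y k := by
            refine Finset.sum_congr rfl fun k _ => ?_
            rw [Finset.sum_mul]
      _ = ∑ k ∈ range 5, (-(mu : ℝ)) * y k := by
            refine Finset.sum_congr rfl fun k hk => ?_
            rw [hcoef' k hk]
      _ = -(mu : ℝ) := by rw [← Finset.mul_sum, hsum, mul_one]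
  -- T < ∑_r L_r R_r / 120000
  have hle' : ∀ r ∈ range 34,
      (L r : ℝ) * (∑ k ∈ range 5, (C r k : ℝ) * y k) ≤ (L r : ℝ) * ((R r : ℝ) / 120000) :=
    fun r hr => mul_le_mul_of_nonneg_left (hle r hr) (hLnn r)
  obtain ⟨r₀, hr₀, hpos⟩ : ∃ r ∈ range 34, (0 : ℤ) < (if S r = true then L r else 0) := by
    have : ∑ r ∈ range 34, (0 : ℤ) < ∑ r ∈ range 34, (if S r = true then L r else 0) := by simpa using hS
    exact Finset.exists_lt_of_sum_lt this
  have hS₀ : S r₀ = true := by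
    by_contra h
    rw [if_neg h] at hpos
    exact lt_irrefl _ hpos
  rw [if_pos hS₀] at hpos
  have hlt₀ : (L r₀ : ℝ) * (∑ k ∈ range 5, (C r₀ k : ℝ) * y k) < (L r₀ : ℝ) * ((R r₀ : ℝ) / 120000) := by
    have hposR : (0 : ℝ) < (L r₀ : ℝ) := by exact_mod_cast hpos
    exact mul_lt_mul_of_pos_left (hlt r₀ hr₀ hS₀) hposR
  have hT2 : ∑ r ∈ range 34, (L r : ℝ) * ∑ k ∈ range 5, (C r k : ℝ) * y k <
      ∑ r ∈ range 34, (L r : ℝ) * ((R r : ℝ) / 120000) :=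
    Finset.sum_lt_sum hle' ⟨r₀, hr₀, hlt₀⟩
  have hR' : (∑ r ∈ range 34, (L r : ℝ) * (R r : ℝ)) + 120000 * (mu : ℝ) ≤ 0 := by
    have h2 : (((∑ r ∈ range 34, L r * R r) + 120000 * mu : ℤ) : ℝ) ≤ 0 := by exact_mod_cast hR
    push_cast at h2
    exact h2
  have hsum' : ∑ r ∈ range 34, (L r : ℝ) * ((R r : ℝ) / 120000) =
      (∑ r ∈ range 34, (L r : ℝ) * (R r : ℝ)) / 120000 := by
    rw [Finset.sum_div]
    refine Finset.sum_congr rfl fun r _ => ?_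
    ring
  rw [hsum', hT1, lt_div_iff₀ (by norm_num : (0 : ℝ) < 120000)] at hT2
  linarith

/-- **Soundness of the Farkas check.** If `farkasOK … lam mu = true` then no `y` with `∑ₖ yₖ = 1` satisfies the 34
rows of the type (`≤` for every row, `<` for the strict ones). [folklore] -/
theorem farkas_sound (a0 a1 a2 a3 a4 b01 b02 b03 b04 b12 b13 b14 b23 b24 b34 : ℕ) (lam : List ℕ) (mu : ℤ)
    (hF : farkasOK a0 a1 a2 a3 a4 b01 b02 b03 b04 b12 b13 b14 b23 b24 b34 lam mu = true)
    (y : ℕ → ℝ) (hsum : ∑ k ∈ range 5, y k = 1)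
    (hle : ∀ r ∈ range 34,
      (∑ k ∈ range 5, (rowC b01 b02 b03 b04 b12 b13 b14 b23 b24 b34 r k : ℝ) * y k) ≤
        (rowR a0 a1 a2 a3 a4 b01 b02 b03 b04 b12 b13 b14 b23 b24 b34 r : ℝ) / 120000)
    (hlt : ∀ r ∈ range 34, rowS b01 b02 b03 b04 b12 b13 b14 b23 b24 b34 r = true →
      (∑ k ∈ range 5, (rowC b01 b02 b03 b04 b12 b13 b14 b23 b24 b34 r k : ℝ) * y k) <
        (rowR a0 a1 a2 a3 a4 b01 b02 b03 b04 b12 b13 b14 b23 b24 b34 r : ℝ) / 120000) : False := by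
  have hF' := hF
  simp only [farkasOK, Bool.and_eq_true, decide_eq_true_eq] at hF'
  obtain ⟨⟨⟨⟨⟨⟨h0, h1⟩, h2⟩, h3⟩, h4⟩, hR⟩, hS⟩ := hF'
  refine farkas_sound_abstract (rowC b01 b02 b03 b04 b12 b13 b14 b23 b24 b34)
    (rowR a0 a1 a2 a3 a4 b01 b02 b03 b04 b12 b13 b14 b23 b24 b34) (rowS b01 b02 b03 b04 b12 b13 b14 b23 b24 b34)
    (fun r => ((lam.getD r 0 : ℕ) : ℤ)) mu (fun r => by positivity) ?_ hR hS y hsum hle hlt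
  intro k hk
  have hk' : k = 0 ∨ k = 1 ∨ k = 2 ∨ k = 3 ∨ k = 4 := by
    have := Finset.mem_range.1 hk; omega
  rcases hk' with rfl | rfl | rfl | rfl | rfl
  · exact h0
  · exact h1
  · exact h2
  · exact h3
  · exact h4

end Summit.Parity.GeneralizedHardyLittlewood.FordMaynardSieveConst01651SieveConst01651
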